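import Summits.ValiantsHypothesis.ValiantsHypothesis.Theorems.NewtonUnitEquationsTwoProductsFormalLogLinearisationDefs
import Summits.ValiantsHypothesis.ValiantsHypothesis.Theorems.NewtonUnitEquationsTwoProductsPlanarCellBlockMerge
import Summits.ValiantsHypothesis.ValiantsHypothesis.Theorems.NewtonUnitEquationsDissociatedUniformQuasiPoly

/-!
# K10 `exp-block-tensorisation` — EXPONENTIAL BLOCK TENSOR: objects, typed targets L1–L3, and the kernel-checked composition (β)

PROVENANCE: the declarations below are lines 30–109 (objects `truncExp`, `restrictBlock`, `expTensor`, `blockFrame`, hypotheses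
`BlockGraded` / `ShallowGraded`, typed targets L1 `ExpTensorCoeff`, L2 `ExpTensorVisible`, L3 `ExpTensorFrames`, corollary target
`BlockGradedQuasiPoly`) and lines 189–219 (the composition `blockGradedQuasiPoly_of`, PROVED: L2 + L3 + the tree's Theorem Q
`NewtonUnitEquationsDissociatedUniform.QuasiPoly.dissociated_quasiPoly` of the sibling crux stmt-5905 ⇒ the quasi-polynomial corollary) of
`pub/ideators/val-idea-37/Sketch-g2-exp-block-tensorisation.lean` (Sketch v3, sha16 02e304dd7d1ec0c9; val-idea-37 g2, crux-ideate on
stmt-ValiantsHypothesis-5906, card `Cruxes/TwoProducts/Ideas/exp-block-tensorisation.md` @8057577e7c9c + addendum; critic of record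
val-idea-crit-8 g2, VERDICT #13 PASS/KEEP = K10; merged-desk RULING #337 (A)(2)), filed VERBATIM by val-lit-p3 g17 (landing hand); the
only changes are the namespace (`…Theorems.NewtonUnitEquations.TwoProducts.ExpBlock`, crit-8's choice), the dropped `import Mathlib` /
`…OfSmallShadow` / `…Theses.NewtonUnitEquations` (unused by these declarations) and this header.
NOT filed (prices unpaid, crit-8 #13): `BlockGradedLaw`, `BlockGradedLaw_of_DissociatedUniform`, `ExpKernel`, the SHALLOW section
(`blockFrameR`, `shallowConfig`, `expCol`, `ShallowVisible`, `ShallowQ` = P1, `BlockShallowQuasiPoly`, `gE_union_subset`, `cshadow_union_subset`).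
LEDGER SHAPE (crit-8 / desk #337): a Theorems helper with typed 5905-side targets; NOT a rung of `relation_ladder.lean` v23 and not
threaded into it; no «shallow coverage» sentence before P1; L1–L3 are `def … : Prop` TARGETS (unproved), only (β) is a theorem.
HONEST LABEL: nothing here closes 5906 or 5905 (`TwoProducts` / `ResidualLawV23` / `PlanarCellBound` / `DissociatedUniform` OPEN);
VP ≠ VNP is NOT proved.  No instances, no notation, no named facts.
-/

noncomputable section

-- Sub = Summit single-conjunct layout: the duplicated namespace component is mandated by the tree.
set_option linter.dupNamespace false

namespace Summit.ValiantsHypothesis.ValiantsHypothesis.Theorems.NewtonUnitEquations.TwoProducts.ExpBlock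

open MvPolynomial Finset
open Summit.ValiantsHypothesis.ValiantsHypothesis.Theorems.NewtonUnitEquations.TwoProducts.FormalLogLinearisation
open Summit.ValiantsHypothesis.ValiantsHypothesis.Theorems.NewtonUnitEquations.TwoProducts.PlanarCell
open Summit.ValiantsHypothesis.ValiantsHypothesis.Theorems.NewtonUnitEquationsDissociatedUniform

variable {m b : ℕ}

/-- Truncated exponential `E_M(q) = Σ_{r ≤ M} q^r / r!`. -/
def truncExp (M : ℕ) (q : MvPolynomial (Fin 2) ℂ) : MvPolynomial (Fin 2) ℂ :=
  ∑ r ∈ Finset.range (M + 1), ((Nat.factorial r : ℂ)⁻¹) • q ^ r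

/-- Restriction of a polynomial to the monomials whose exponent lies in block `B` of the block map `blk`. -/
def restrictBlock (blk : Expo → Fin b) (B : Fin b) (q : MvPolynomial (Fin 2) ℂ) : MvPolynomial (Fin 2) ℂ :=
  ∑ e ∈ q.support.filter (fun e => blk e = B), monomial e (coeff e q)

/-- The EXPONENTIAL BLOCK TENSOR `𝒲 = Σ_j Π_B E_m(u_j|_B) − Σ_j Π_B E_m(v_j|_B)`. -/
def expTensor (blk : Expo → Fin b) (u v : Fin m → MvPolynomial (Fin 2) ℂ) : MvPolynomial (Fin 2) ℂ :=
  ∑ j, ∏ B, truncExp m (restrictBlock blk B (u j)) - ∑ j, ∏ B, truncExp m (restrictBlock blk B (v j))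

/-- The block frame of block `B`: all sums of at most `m` letters of `A` lying in block `B` (with repetition; `0` included). -/
def blockFrame (A : Finset Expo) (blk : Expo → Fin b) (m : ℕ) (B : Fin b) : Finset Expo :=
  (Finset.range (m + 1)).biUnion fun r =>
    ((∑ e ∈ A.filter (fun e => blk e = B), (monomial e (1 : ℂ) : MvPolynomial (Fin 2) ℂ)) ^ r).support

/-- `BlockGraded A blk m` (the hypothesis of the rung): a multiset of letters of `A` with at most `m` letters in each block and ANY
multiset of letters of `A` with the same planar sum agree block by block, in sum and in number of letters.  (The blocks are
mutually dissociated and internally graded, to the depth the block frames need; singleton blocks = free letters; a block containing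
a tower `e, 2e` or any inhomogeneous relation violates it.) -/
def BlockGraded (A : Finset Expo) (blk : Expo → Fin b) (m : ℕ) : Prop :=
  ∀ k k' : Multiset Expo, (∀ e ∈ k, e ∈ A) → (∀ e ∈ k', e ∈ A) →
    (∀ B, Multiset.card (k.filter (fun e => blk e = B)) ≤ m) → k.sum = k'.sum →
    ∀ B, (k.filter (fun e => blk e = B)).sum = (k'.filter (fun e => blk e = B)).sum ∧
      Multiset.card (k.filter (fun e => blk e = B)) = Multiset.card (k'.filter (fun e => blk e = B))

/-- `ShallowGraded A blk m` (the NATURAL, weaker hypothesis): the same, but only for multisets `k` with at most `m` letters in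
total (genericity only up to what `m`-fold sums reach). -/
def ShallowGraded (A : Finset Expo) (blk : Expo → Fin b) (m : ℕ) : Prop :=
  ∀ k k' : Multiset Expo, (∀ e ∈ k, e ∈ A) → (∀ e ∈ k', e ∈ A) → Multiset.card k ≤ m → k.sum = k'.sum →
    ∀ B, (k.filter (fun e => blk e = B)).sum = (k'.filter (fun e => blk e = B)).sum ∧
      Multiset.card (k.filter (fun e => blk e = B)) = Multiset.card (k'.filter (fun e => blk e = B))

/-- FIRST LEMMA (L1, the identity; M-sized): on a block-graded alphabet, at every point `p = k.sum` of the block frames,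
`logDiff u v p = (−1)^{|k|+1} (|k|−1)! · coeff_p 𝒲` (cumulants vs. moments: the universal constant of
`TwoProducts.DissocBridge` is constant on a GRADED fibre, and the fibre of `p` is the product of its block fibres). -/
def ExpTensorCoeff : Prop :=
  ∀ (m b : ℕ) (u v : Fin m → MvPolynomial (Fin 2) ℂ) (A : Finset Expo) (blk : Expo → Fin b),
    (∀ j, coeff 0 (u j) = 0 ∧ (u j).support ⊆ A) → (∀ j, coeff 0 (v j) = 0 ∧ (v j).support ⊆ A) →
    BlockGraded A blk m →
    ∀ k : Multiset Expo, (∀ e ∈ k, e ∈ A) → (∀ B, Multiset.card (k.filter (fun e => blk e = B)) ≤ m) → k ≠ 0 →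
      logDiff u v k.sum =
        (-1 : ℂ) ^ (Multiset.card k + 1) * (Nat.factorial (Multiset.card k - 1) : ℂ) * coeff k.sum (expTensor blk u v)

/-- FIRST LEMMA (L2, what the count uses; S from L1 + `DissociatedFixedK.Negative.mem_extremePoints_convexHull_of_strict_sep`):
`supp 𝒲 ⊆ supp D`, hence every strict `ξ`-top of `supp D` for a valid `ξ` (every visible point of every cell) is a vertex of
`Newt 𝒲`. -/
def ExpTensorVisible : Prop :=
  ∀ (m b : ℕ) (u v : Fin m → MvPolynomial (Fin 2) ℂ) (A : Finset Expo) (blk : Expo → Fin b),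
    (∀ j, coeff 0 (u j) = 0 ∧ (u j).support ⊆ A) → (∀ j, coeff 0 (v j) = 0 ∧ (v j).support ⊆ A) →
    BlockGraded A blk m →
    ∀ (ξ : Fin 2 → ℝ) (l : Expo), ValidWeight u v ξ → IsStrictTop ξ (logSupport u v) l →
      (fun i : Fin 2 => ((l i : ℕ) : ℝ)) ∈
        Set.extremePoints ℝ (convexHull ℝ ((fun e : Expo => fun i : Fin 2 => ((e i : ℕ) : ℝ)) ''
          ((expTensor blk u v).support : Set Expo)))

/-- L3 (packaging; S): `𝒲` is a sum of `2m` products of one factor per block, the factors supported on the block frames, and the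
block frames of a block-graded alphabet are DISSOCIATED (the sum map on `Π_B frame_B` is injective) of size `≤ (m+1)^{#B}`. -/
def ExpTensorFrames : Prop :=
  ∀ (m b : ℕ) (u v : Fin m → MvPolynomial (Fin 2) ℂ) (A : Finset Expo) (blk : Expo → Fin b),
    (∀ j, coeff 0 (u j) = 0 ∧ (u j).support ⊆ A) → (∀ j, coeff 0 (v j) = 0 ∧ (v j).support ⊆ A) →
    BlockGraded A blk m →
    (∃ f : Fin (m + m) → Fin b → MvPolynomial (Fin 2) ℂ,
        (∑ i, ∏ B, f i B) = expTensor blk u v ∧ ∀ i B, (f i B).support ⊆ blockFrame A blk m B) ∧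
    (∀ a c : Fin b → Expo, (∀ B, a B ∈ blockFrame A blk m B) → (∀ B, c B ∈ blockFrame A blk m B) →
        ∑ B, a B = ∑ B, c B → a = c) ∧
    (∀ B, (blockFrame A blk m B).card ≤ (m + 1) ^ (A.filter (fun e => blk e = B)).card)

/-- COROLLARY TARGET (unconditional today, from L2 + L3 + Theorem Q `dissociated_quasiPoly` of the 5905 line): on a block-graded
alphabet with `b` blocks and block frames of size `≤ s`, every cell family — indeed the set of ALL visible points — has at most
`(s + 2) · (8 (2m + 2)^3)^⌈log₂ b⌉` elements (quasi-polynomial `(m t)^{O(log m)}` for blocks of `≤ C₀` letters, where only the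
trivial `t^{Θ(m)}` was known: R10's slice count is void at `#L ≍ t`). -/
def BlockGradedQuasiPoly : Prop :=
  ∀ (m b s : ℕ) (u v : Fin m → MvPolynomial (Fin 2) ℂ) (A : Finset Expo) (blk : Expo → Fin b),
    (∀ j, coeff 0 (u j) = 0 ∧ (u j).support ⊆ A) → (∀ j, coeff 0 (v j) = 0 ∧ (v j).support ⊆ A) →
    BlockGraded A blk m → (∀ B, (blockFrame A blk m B).card ≤ s) →
    ∀ (R : Expo → Expo → Prop) (S : Finset Expo), IsCellFamily u v R S →
      S.card ≤ (s + 2) * (8 * (m + m + 2) ^ 3) ^ Nat.clog 2 b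

/-! ## Kernel-checked composition (bookkeeping only): L2 + L3 + Theorem Q ⇒ the quasi-polynomial corollary -/

/-- The corollary `BlockGradedQuasiPoly` IS `ExpTensorVisible` + `ExpTensorFrames` + the tree's Theorem Q
(`dissociated_quasiPoly`), nothing else. -/
theorem blockGradedQuasiPoly_of (h2 : ExpTensorVisible) (h3 : ExpTensorFrames) : BlockGradedQuasiPoly := by
  classical
  intro m b s u v A blk hu hv hG hs R S hS
  obtain ⟨⟨f, hfW, hfsupp⟩, hdis, -⟩ := h3 m b u v A blk hu hv hG
  have hQ := dissociated_quasiPoly (m + m) b s (blockFrame A blk m) f hs hfsupp hdis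
  rw [hfW] at hQ
  have hinj : Set.InjOn (fun e : Expo => fun i : Fin 2 => ((e i : ℕ) : ℝ)) (S : Set Expo) := by
    intro e _ e' _ h
    ext i
    have hi : ((e i : ℕ) : ℝ) = ((e' i : ℕ) : ℝ) := congrFun h i
    exact_mod_cast hi
  have hmaps : Set.MapsTo (fun e : Expo => fun i : Fin 2 => ((e i : ℕ) : ℝ)) (S : Set Expo)
      (Set.extremePoints ℝ (convexHull ℝ ((fun e : Expo => fun i : Fin 2 => ((e i : ℕ) : ℝ)) ''
        ((expTensor blk u v).support : Set Expo)))) := by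
    intro l hl
    obtain ⟨ξ, hξ, htop, -⟩ := hS l hl
    exact h2 m b u v A blk hu hv hG ξ l hξ htop
  have hfin : (Set.extremePoints ℝ (convexHull ℝ ((fun e : Expo => fun i : Fin 2 => ((e i : ℕ) : ℝ)) ''
      ((expTensor blk u v).support : Set Expo)))).Finite :=
    Set.Finite.subset ((expTensor blk u v).support.finite_toSet.image _) extremePoints_convexHull_subset
  calc S.card = (S : Set Expo).ncard := (Set.ncard_coe_finset S).symm
    _ ≤ (Set.extremePoints ℝ (convexHull ℝ ((fun e : Expo => fun i : Fin 2 => ((e i : ℕ) : ℝ)) ''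
          ((expTensor blk u v).support : Set Expo)))).ncard :=
        Set.ncard_le_ncard_of_injOn _ hmaps hinj hfin
    _ ≤ (s + 2) * (8 * (m + m + 2) ^ 3) ^ Nat.clog 2 b := hQ

/-! ## APPENDED (val-lit-p3 g17, second revision): the SHALLOW section — lines 137–188 of the same Sketch v3 (sha16 02e304dd7d1ec0c9),
VERBATIM: `blockFrameR`, `shallowConfig`, `expCol`, the typed targets `ShallowVisible`, `ShallowQ` (= crit-8's price P1) and
`BlockShallowQuasiPoly`.  `ShallowQ` is PROVED in `…ExpBlockShallowQ` (`shallowQ_holds`); `ShallowVisible` / `BlockShallowQuasiPoly` remain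
TARGETS.  Same honest label: nothing closes 5906 or 5905; VP ≠ VNP NOT proved. -/

/-! ## The natural hypothesis: SHALLOW frames (addendum, same session)

Under `ShallowGraded` only tuples with `≤ m` letters in total are controlled.  The 5905 product step
`QuasiPoly.ncard_cshadow_prod_le` is stated for ARBITRARY finite configurations `E₁ ×ˢ E₂`, and `cshadow` is subadditive under
unions (novel in `E ∪ E'` ⇒ novel in the part containing the point), while the shallow configuration over `B₁ ⊔ B₂` is the union over
`m₁ + m₂ = m` of products of shallow configurations — so Theorem Q re-runs on the Hamming-ball configuration with an extra factor
`(m+1)` per halving.  Targets typed below; nothing proved. -/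

/-- Exactly-`r`-letter sums of block `B`. -/
def blockFrameR (A : Finset Expo) (blk : Expo → Fin b) (r : ℕ) (B : Fin b) : Finset Expo :=
  ((∑ e ∈ A.filter (fun e => blk e = B), (monomial e (1 : ℂ) : MvPolynomial (Fin 2) ℂ)) ^ r).support

/-- The SHALLOW configuration: block tuples carrying at most `m` letters in total. -/
def shallowConfig (A : Finset Expo) (blk : Expo → Fin b) (m : ℕ) : Finset (Fin b → Expo) :=
  (Fintype.piFinset (blockFrame A blk m)).filter fun a =>
    ∃ r : Fin b → Fin (m + 1), (∑ B, (r B : ℕ)) ≤ m ∧ ∀ B, a B ∈ blockFrameR A blk (r B) B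

/-- The `2m` Khatri–Rao columns of the exponential block tensor (signs dropped: spans do not see them). -/
def expCol (blk : Expo → Fin b) (u v : Fin m → MvPolynomial (Fin 2) ℂ) (a : Fin b → Expo) : Fin (m + m) → ℂ :=
  fun i => ∏ B, coeff (a B) (truncExp m (restrictBlock blk B (Fin.append u v i)))

/-- L2♭ (shallow form of `ExpTensorVisible`; M): under `ShallowGraded` every visible point is the point of a tuple in the
configuration shadow of the SHALLOW configuration (strict top of `supp D` ⇒ the `2m`-column of its tuple is not in the span of the
columns of the higher shallow tuples, on which `D`'s coefficients — hence the signed column sums — vanish). -/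
def ShallowVisible : Prop :=
  ∀ (m b : ℕ) (u v : Fin m → MvPolynomial (Fin 2) ℂ) (A : Finset Expo) (blk : Expo → Fin b),
    (∀ j, coeff 0 (u j) = 0 ∧ (u j).support ⊆ A) → (∀ j, coeff 0 (v j) = 0 ∧ (v j).support ⊆ A) →
    ShallowGraded A blk m →
    ∀ (ξ : Fin 2 → ℝ) (l : Expo), ValidWeight u v ξ → IsStrictTop ξ (logSupport u v) l →
      ∃ a ∈ QuasiPoly.cshadow (shallowConfig A blk m) (expCol blk u v)
          (fun a => ((((∑ B, a B) (0 : Fin 2)) : ℕ) : ℝ)) (fun a => ((((∑ B, a B) (1 : Fin 2)) : ℕ) : ℝ)),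
        ∑ B, a B = l

/-- SHALLOW THEOREM Q (M; the variant the natural hypothesis needs): the configuration shadow of the shallow configuration of a
shallow-graded alphabet with `b` blocks and block frames of size `≤ s` has at most `(s+2)·((m+1)·8(2m+2)³)^⌈log₂ b⌉` points. -/
def ShallowQ : Prop :=
  ∀ (m b s : ℕ) (u v : Fin m → MvPolynomial (Fin 2) ℂ) (A : Finset Expo) (blk : Expo → Fin b),
    (∀ j, coeff 0 (u j) = 0 ∧ (u j).support ⊆ A) → (∀ j, coeff 0 (v j) = 0 ∧ (v j).support ⊆ A) →
    ShallowGraded A blk m → (∀ B, (blockFrame A blk m B).card ≤ s) →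
    (QuasiPoly.cshadow (shallowConfig A blk m) (expCol blk u v)
        (fun a => ((((∑ B, a B) (0 : Fin 2)) : ℕ) : ℝ)) (fun a => ((((∑ B, a B) (1 : Fin 2)) : ℕ) : ℝ))).ncard ≤
      (s + 2) * ((m + 1) * (8 * (m + m + 2) ^ 3)) ^ Nat.clog 2 b

/-- COROLLARY TARGET under the natural hypothesis (S from `ShallowVisible` + `ShallowQ`). -/
def BlockShallowQuasiPoly : Prop :=
  ∀ (m b s : ℕ) (u v : Fin m → MvPolynomial (Fin 2) ℂ) (A : Finset Expo) (blk : Expo → Fin b),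
    (∀ j, coeff 0 (u j) = 0 ∧ (u j).support ⊆ A) → (∀ j, coeff 0 (v j) = 0 ∧ (v j).support ⊆ A) →
    ShallowGraded A blk m → (∀ B, (blockFrame A blk m B).card ≤ s) →
    ∀ (R : Expo → Expo → Prop) (S : Finset Expo), IsCellFamily u v R S →
      S.card ≤ (s + 2) * ((m + 1) * (8 * (m + m + 2) ^ 3)) ^ Nat.clog 2 b

end Summit.ValiantsHypothesis.ValiantsHypothesis.Theorems.NewtonUnitEquations.TwoProducts.ExpBlock

end
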